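import Summits.HodgeConjecture.CorCM.MumfordTateRankSurfaces
import Summits.HodgeConjecture.CorCM.MumfordTateRankSevenSplitConverse
import Summits.HodgeConjecture.CorCM.MumfordTateRankSemisimpleTimesCM
import Summits.HodgeConjecture.CorCM.MumfordTateRankFour
import Literature.AlgebraicGeometry.HodgeTheory.NoTypeIVTimesCMGrouping
import HarnessLib

/-!
# The Mumford–Tate rank of a product of two elliptic curves: the table `2, 3, 4, 5, 7`

Sub-problem `CorCM` of `HodgeConjecture` (cell `pub-hodgecm2`, count-neutral Mumford–Tate-rank lane of seat `b27`; theorems only,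
no new definition, no named fact; nothing here uses or asserts `HC_CM`).  Completes `CorCM/MumfordTateRankSurfaces` (every abelian
surface has `t ∈ {2, 3, 4, 5, 7, 11}`; a non-simple one is `∼ E₁ × E₂`) by the exact value for `X ∼ E₁ × E₂`, `E₁, E₂` elliptic curves:

| `E₁`, `E₂`                         | `t(X) = dim MT(H¹X)` | source                                                        |
|------------------------------------|----------------------|---------------------------------------------------------------|
| CM, isogenous                      | `2`                  | `CorCM/MumfordTateRankTwo` (`X ∼ E^{2}`)                       |
| CM, CM, not isogenous              | `3`                  | `CorCM/MumfordTateRankThree` (two CM curves)                  |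
| non-CM, isogenous                  | `4`                  | `CorCM/MumfordTateRankFour` + `CorCM/MumfordTateRankOfPowers` |
| non-CM, CM                         | `5`                  | `CorCM/MumfordTateRankSemisimpleTimesCM` (`t + 1 = 4 + 2`)     |
| non-CM, non-CM, not isogenous      | `7`                  | `CorCM/MumfordTateRankSevenSplitConverse`                     |

(`prod_isIsogenous_biproduct_two`: `E₁ × E₂ ≅ ⨁_{Fin 2} ![E₁, E₂]`, the glue to the tree's biproduct-indexed rungs.)

## References
* [MoonenZarhin1999LowDim] B. Moonen, Yu. G. Zarhin, *Hodge classes on abelian varieties of low dimension*, Math. Ann. 315 (1999), §2, §3.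
* [Gordon1999HodgeAVSurvey] B. B. Gordon, *A survey of the Hodge conjecture for abelian varieties* (1999), §7.
-/

noncomputable section

namespace Summit.HodgeConjecture.CorCM

open scoped TensorProduct
open CategoryTheory CategoryTheory.Limits Module
open Literature.AlgebraicGeometry.Motives
open Literature.AlgebraicGeometry.Motives.AbelianVariety
open Literature.AlgebraicGeometry.Motives.HodgeStructure
open Literature.AlgebraicGeometry.HodgeTheory
open Literature.AlgebraicGeometry.Milne1999 (IsOfCMType)

variable [HodgeTensorFacts.{0, 0}]

/-! ## §0 Glue and elliptic-curve facts -/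

omit [HodgeTensorFacts.{0, 0}] in
/-- `E₁ × E₂ ∼ ⨁_{j : Fin 2} ![E₁, E₂] j` (both are the product). [folklore] -/
theorem prod_isIsogenous_biproduct_two (E₁ E₂ : AbelianVariety ℂ) :
    IsIsogenous (E₁.prod E₂) (⨁ fun j : Fin 2 => (![E₁, E₂] : Fin 2 → AbelianVariety ℂ) j) := by
  classical
  let f : Fin 2 → AbelianVariety ℂ := ![E₁, E₂]
  let g : ∀ j : Fin 2, E₁.prod E₂ ⟶ f j := fun j =>
    Fin.cases (motive := fun j => E₁.prod E₂ ⟶ f j) (fst E₁ E₂)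
      (fun i => Fin.cases (motive := fun i : Fin 1 => E₁.prod E₂ ⟶ f i.succ) (snd E₁ E₂) (fun k => k.elim0) i) j
  have hg0 : g 0 = fst E₁ E₂ := rfl
  have hg1 : g 1 = snd E₁ E₂ := rfl
  let e : E₁.prod E₂ ≅ ⨁ f :=
    { hom := biproduct.lift g
      inv := prodLift (biproduct.π f 0) (biproduct.π f 1)
      hom_inv_id := prod_hom_ext
        (by rw [Category.assoc, prodLift_fst]; erw [biproduct.lift_π]; rw [hg0, Category.id_comp])
        (by rw [Category.assoc, prodLift_snd]; erw [biproduct.lift_π]; rw [hg1, Category.id_comp])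
      inv_hom_id := biproduct.hom_ext _ _ fun j => by
        rw [Category.assoc, biproduct.lift_π, Category.id_comp]
        fin_cases j
        · exact prodLift_fst _ _
        · exact prodLift_snd _ _ }
  exact ⟨e.hom, isIsogeny_hom_of_iso e⟩

/-- A non-CM elliptic curve: `t = 4`, `End⁰ = ℚ` (`dim 1`), no factor of type IV, centre of dimension `1`.
[cite: MoonenZarhin1999LowDim, §2] -/
theorem curve_facts_of_not_isOfCMType {E : AbelianVariety ℂ} (hE1 : E.dim = 1) (hcm : ¬ IsOfCMType E) :
    haveI := BettiUniverse.finite (AbelianVariety.isSmoothProjective_holds (A := E)) 1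
    (BettiUniverse.hodge exists_isReal_hodgeModel_holds (AbelianVariety.isSmoothProjective_holds (A := E)) 1).mtRank = 4 ∧
      Module.finrank ℚ E.endAlgebra = 1 ∧ HasNoTypeIVFactor E ∧
      Module.finrank ℚ (Subalgebra.center ℚ E.endAlgebra) = 1 := by
  have hE := AbelianVariety.isSmoothProjective_holds (A := E)
  haveI := BettiUniverse.finite hE 1
  have h4 := mtRank_hodge_one_eq_four_of_dim_one hE hE1 hcm
  obtain ⟨hsq, -, -⟩ := finrank_endAlgebra_eq_dim_sq_of_not_isOfCMType hE (by omega) hcm h4.le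
  rw [hE1, one_pow] at hsq
  haveI : Nontrivial E.endAlgebra :=
    Literature.AlgebraicGeometry.ComplexMultiplication.nontrivial_endAlgebra_of_dim_pos (by omega)
  have hbt : (⊥ : Subalgebra ℚ E.endAlgebra) = ⊤ := Subalgebra.bot_eq_top_iff_finrank_eq_one.2 hsq
  have hcen : Subalgebra.center ℚ E.endAlgebra = ⊥ := le_antisymm (hbt ▸ le_top) bot_le
  refine ⟨h4, hsq, hasNoTypeIVFactor_of_endAlgebra_eq_bot hbt.symm, ?_⟩
  rw [hcen, Subalgebra.finrank_bot]

/-- A CM elliptic curve has `t = 2`. [cite: MoonenZarhin1999LowDim, §2] -/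
theorem mtRank_hodge_one_eq_two_of_cm_curve {E : AbelianVariety ℂ} (hE1 : E.dim = 1) (hcm : IsOfCMType E) :
    haveI := BettiUniverse.finite (AbelianVariety.isSmoothProjective_holds (A := E)) 1
    (BettiUniverse.hodge exists_isReal_hodgeModel_holds (AbelianVariety.isSmoothProjective_holds (A := E)) 1).mtRank = 2 :=
  mtRank_hodge_one_eq_two_of_isIsogenous_powSucc (AbelianVariety.isSmoothProjective_holds (A := E)) hE1 hcm (N := 0)
    (IsIsogenous.refl E)

/-! ## §1 The table -/

/-- **`t(E₁ × E₂) = 2` for isogenous CM curves** (`X ∼ E₁²`). [cite: MoonenZarhin1999LowDim, §2] -/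
theorem mtRank_hodge_one_eq_two_of_isIsogenous_prod_curves {X : AbelianVariety ℂ} {n : ℕ} (hX : IsSmoothProjective n X.X)
    {E₁ E₂ : AbelianVariety ℂ} (hE₁ : E₁.dim = 1) (hcm : IsOfCMType E₁) (h12 : IsIsogenous E₁ E₂)
    (hXE : IsIsogenous X (E₁.prod E₂)) :
    haveI := BettiUniverse.finite hX 1
    (BettiUniverse.hodge exists_isReal_hodgeModel_holds hX 1).mtRank = 2 :=
  mtRank_hodge_one_eq_two_of_isIsogenous_powSucc hX hE₁ hcm (N := 1) (hXE.trans ((IsIsogenous.refl E₁).prod h12.symm'))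

/-- **`t(E₁ × E₂) = 3` for two NON-isogenous CM curves.** [cite: MoonenZarhin1999LowDim, §2] [cite: Gordon1999HodgeAVSurvey, 7.5] -/
theorem mtRank_hodge_one_eq_three_of_isIsogenous_prod_curves {X : AbelianVariety ℂ} {n : ℕ} (hX : IsSmoothProjective n X.X)
    {E₁ E₂ : AbelianVariety ℂ} (hE₁ : E₁.dim = 1) (hE₂ : E₂.dim = 1) (hcm₁ : IsOfCMType E₁) (hcm₂ : IsOfCMType E₂)
    (h12 : ¬ IsIsogenous E₁ E₂) (hXE : IsIsogenous X (E₁.prod E₂)) :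
    haveI := BettiUniverse.finite hX 1
    (BettiUniverse.hodge exists_isReal_hodgeModel_holds hX 1).mtRank = 3 := by
  have h := mtRank_hodge_one_eq_card_add_one_of_isIsogenous_biproduct_elliptic (C := Fin 2)
    (E := (![E₁, E₂] : Fin 2 → AbelianVariety ℂ)) (m := 1) (cls := id)
    (fun c => by fin_cases c <;> assumption) (fun c => by fin_cases c <;> assumption)
    (fun c c' hcc' => by
      fin_cases c <;> fin_cases c'
      · exact absurd rfl hcc'
      · exact h12
      · exact fun h => h12 h.symm'
      · exact absurd rfl hcc')
    Function.surjective_id hX (hXE.trans (prod_isIsogenous_biproduct_two E₁ E₂))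
  simpa using h

/-- **`t(E₁ × E₂) = 4` for isogenous NON-CM curves** (`X ∼ E₁²`, `t(E₁²) = t(E₁) = 4`). [cite: MoonenZarhin1999LowDim, §2] -/
theorem mtRank_hodge_one_eq_four_of_isIsogenous_prod_curves {X : AbelianVariety ℂ} {n : ℕ} (hX : IsSmoothProjective n X.X)
    {E₁ E₂ : AbelianVariety ℂ} (hE₁ : E₁.dim = 1) (hcm : ¬ IsOfCMType E₁) (h12 : IsIsogenous E₁ E₂)
    (hXE : IsIsogenous X (E₁.prod E₂)) :
    haveI := BettiUniverse.finite hX 1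
    (BettiUniverse.hodge exists_isReal_hodgeModel_holds hX 1).mtRank = 4 := by
  have h := mtRank_hodge_one_eq_of_isIsogenous_powSucc hX (AbelianVariety.isSmoothProjective_holds (A := E₁)) (by omega)
    (m := 1) (hXE.trans ((IsIsogenous.refl E₁).prod h12.symm'))
  rw [h]
  exact (curve_facts_of_not_isOfCMType hE₁ hcm).1

/-- **`t(E₁ × E₂) = 5` for a NON-CM curve `E₁` and a CM curve `E₂`** (`t + 1 = t(E₁) + t(E₂) = 4 + 2`: `E₁` has no factor of type IV,
`E₂` is of CM type). [cite: MoonenZarhin1999LowDim, §3 Thm. (3.2)(2)] -/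
theorem mtRank_hodge_one_eq_five_of_isIsogenous_prod_curves {X : AbelianVariety ℂ} {n : ℕ} (hX : IsSmoothProjective n X.X)
    {E₁ E₂ : AbelianVariety ℂ} (hE₁ : E₁.dim = 1) (hE₂ : E₂.dim = 1) (hcm₁ : ¬ IsOfCMType E₁) (hcm₂ : IsOfCMType E₂)
    (hXE : IsIsogenous X (E₁.prod E₂)) :
    haveI := BettiUniverse.finite hX 1
    (BettiUniverse.hodge exists_isReal_hodgeModel_holds hX 1).mtRank = 5 := by
  obtain ⟨h4, -, hA4, -⟩ := curve_facts_of_not_isOfCMType hE₁ hcm₁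
  have h2 := mtRank_hodge_one_eq_two_of_cm_curve hE₂ hcm₂
  have h := mtRank_hodge_one_add_one_eq_add_of_isIsogenous_prod hX (AbelianVariety.isSmoothProjective_holds (A := E₁))
    (AbelianVariety.isSmoothProjective_holds (A := E₂)) (by omega) (by omega) hA4 hcm₂ hXE
  omega

/-- The same with the factors swapped: **`t(E₁ × E₂) = 5` for a CM curve `E₁` and a non-CM curve `E₂`.**
[cite: MoonenZarhin1999LowDim, §3 Thm. (3.2)(2)] -/
theorem mtRank_hodge_one_eq_five_of_isIsogenous_prod_curves' {X : AbelianVariety ℂ} {n : ℕ} (hX : IsSmoothProjective n X.X)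
    {E₁ E₂ : AbelianVariety ℂ} (hE₁ : E₁.dim = 1) (hE₂ : E₂.dim = 1) (hcm₁ : IsOfCMType E₁) (hcm₂ : ¬ IsOfCMType E₂)
    (hXE : IsIsogenous X (E₁.prod E₂)) :
    haveI := BettiUniverse.finite hX 1
    (BettiUniverse.hodge exists_isReal_hodgeModel_holds hX 1).mtRank = 5 :=
  mtRank_hodge_one_eq_five_of_isIsogenous_prod_curves hX hE₂ hE₁ hcm₂ hcm₁ (hXE.trans (Literature.AlgebraicGeometry.HodgeTheory.isIsogenous_prod_comm E₁ E₂))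

/-- **`t(E₁ × E₂) = 7` for two NON-isogenous NON-CM curves** (`Hg = SL₂ × SL₂`). [cite: MoonenZarhin1999LowDim, §2 and §3 (3.1)] -/
theorem mtRank_hodge_one_eq_seven_of_isIsogenous_prod_curves {X : AbelianVariety ℂ} {n : ℕ} (hX : IsSmoothProjective n X.X)
    {E₁ E₂ : AbelianVariety ℂ} (hE₁ : E₁.dim = 1) (hE₂ : E₂.dim = 1) (hcm₁ : ¬ IsOfCMType E₁) (hcm₂ : ¬ IsOfCMType E₂)
    (h12 : ¬ IsIsogenous E₁ E₂) (hXE : IsIsogenous X (E₁.prod E₂)) :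
    haveI := BettiUniverse.finite hX 1
    (BettiUniverse.hodge exists_isReal_hodgeModel_holds hX 1).mtRank = 7 := by
  obtain ⟨-, hf₁, -, hz₁⟩ := curve_facts_of_not_isOfCMType hE₁ hcm₁
  obtain ⟨-, hf₂, -, hz₂⟩ := curve_facts_of_not_isOfCMType hE₂ hcm₂
  exact (mtRank_hodge_one_eq_seven_of_isIsogenous_powSucc_prod_powSucc hX (isSimple_of_dim_le_one hE₁.le)
    (isSimple_of_dim_le_one hE₂.le) (by omega) (by omega) (by omega) (by omega) hcm₁ hcm₂ (by rw [hf₁, hE₁]; rfl) hz₁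
    (by rw [hf₂, hE₂]; rfl) hz₂ h12 (a := 0) (b := 0) hXE).1

/-- **The table, assembled:** for `X ∼ E₁ × E₂` with elliptic curves `E₁, E₂`, `t(X)` is `2, 3, 4, 5` or `7` according to the CM
types and the isogeny relation of the factors. [cite: MoonenZarhin1999LowDim, §2 and §3] -/
theorem mtRank_hodge_one_of_isIsogenous_prod_curves {X : AbelianVariety ℂ} {n : ℕ} (hX : IsSmoothProjective n X.X)
    {E₁ E₂ : AbelianVariety ℂ} (hE₁ : E₁.dim = 1) (hE₂ : E₂.dim = 1) (hXE : IsIsogenous X (E₁.prod E₂)) :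
    haveI := BettiUniverse.finite hX 1
    (IsOfCMType E₁ ∧ IsOfCMType E₂ ∧ IsIsogenous E₁ E₂ ∧ (BettiUniverse.hodge exists_isReal_hodgeModel_holds hX 1).mtRank = 2) ∨
      (IsOfCMType E₁ ∧ IsOfCMType E₂ ∧ ¬ IsIsogenous E₁ E₂ ∧ (BettiUniverse.hodge exists_isReal_hodgeModel_holds hX 1).mtRank = 3) ∨
      (¬ IsOfCMType E₁ ∧ ¬ IsOfCMType E₂ ∧ IsIsogenous E₁ E₂ ∧ (BettiUniverse.hodge exists_isReal_hodgeModel_holds hX 1).mtRank = 4) ∨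
      (¬ (IsOfCMType E₁ ↔ IsOfCMType E₂) ∧ (BettiUniverse.hodge exists_isReal_hodgeModel_holds hX 1).mtRank = 5) ∨
      (¬ IsOfCMType E₁ ∧ ¬ IsOfCMType E₂ ∧ ¬ IsIsogenous E₁ E₂ ∧
        (BettiUniverse.hodge exists_isReal_hodgeModel_holds hX 1).mtRank = 7) := by
  by_cases h₁ : IsOfCMType E₁ <;> by_cases h₂ : IsOfCMType E₂
  · by_cases h12 : IsIsogenous E₁ E₂
    · exact Or.inl ⟨h₁, h₂, h12, mtRank_hodge_one_eq_two_of_isIsogenous_prod_curves hX hE₁ h₁ h12 hXE⟩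
    · exact Or.inr (Or.inl ⟨h₁, h₂, h12, mtRank_hodge_one_eq_three_of_isIsogenous_prod_curves hX hE₁ hE₂ h₁ h₂ h12 hXE⟩)
  · exact Or.inr (Or.inr (Or.inr (Or.inl ⟨fun h => h₂ (h.1 h₁),
      mtRank_hodge_one_eq_five_of_isIsogenous_prod_curves' hX hE₁ hE₂ h₁ h₂ hXE⟩)))
  · exact Or.inr (Or.inr (Or.inr (Or.inl ⟨fun h => h₁ (h.2 h₂),
      mtRank_hodge_one_eq_five_of_isIsogenous_prod_curves hX hE₁ hE₂ h₁ h₂ hXE⟩)))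
  · by_cases h12 : IsIsogenous E₁ E₂
    · exact Or.inr (Or.inr (Or.inl ⟨h₁, h₂, h12, mtRank_hodge_one_eq_four_of_isIsogenous_prod_curves hX hE₁ h₁ h12 hXE⟩))
    · exact Or.inr (Or.inr (Or.inr (Or.inr ⟨h₁, h₂, h12,
        mtRank_hodge_one_eq_seven_of_isIsogenous_prod_curves hX hE₁ hE₂ h₁ h₂ h12 hXE⟩)))

end Summit.HodgeConjecture.CorCM

end
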